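import Literature.MathematicalPhysics.QuantumLattice.HubbardTTPrimeTPPKinematicLipschitz
import Literature.MathematicalPhysics.QuantumLattice.HubbardTTPrimeTPPFillingTransport
import Literature.MathematicalPhysics.QuantumLattice.HubbardTTPrimeAffineBoxWordAdapters
import HarnessLib

/-!
# Object-M cap words on `(U, t', t'', n)` boxes: density chords of `t''`-exact cluster planes, affine and
# constant caps by the vertex rule, and the two-sided word with a transported `t–t'` floor

Topic `MathematicalPhysics/QuantumLattice`, family `hubbard`. Object M of the material-oracle seam is the
translation-invariant fixed-filling variational energy density
`e^M(t, s, r, u; n) = (hubbardTT'T''FermionInteraction t s r u).tiGroundEnergyDensityAt 2 n` of the `t–t'–t''`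
Hubbard model of `ℤ²` (`s = t'/t`, `r = t''/t`, `u = U/t`). A kernel open-cluster certificate
(`HubbardOpenBoxEDUpperCertificateAxial2`, `UpperCert.sound₆`) produces, at a CLUSTER density `m = N/|C|`, a
PLANE `e^M(1, s, r, u; m) ≤ P + Q u + S s + T r` valid on a sign quadrant of `(s, r)` and all `u ≥ 0`. This
file is the bookkeeping that turns such planes into words on a typed four-dimensional box
`[U₁, U₂] × [s₁, s₂] × [r₁, r₂] × [n₁, n₂]`:

* §1 `e^M` is CONVEX IN THE DENSITY on `(0, 2)` (the tree's model-free `convexOn_tiGroundEnergyDensityAt`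
  + realised densities `exists_isTranslationInvariant_density_eq`), and the closed two-point density chord;
* §2 restriction of quadrant planes to a box (`tpp_boxPlane_of_{np,nn,pp,pn}`);
* §3 **a plane at an arbitrary density from two cluster-density planes** (convex weights `l₁ m₁ + l₂ m₂ = n`;
  eight vertex checks; `tpp_boxPlane_of_densityChord`);
* §4 **affine cap on the 4-box from two end-density planes** (density chord + vertex rule; sixteen checks;
  `tpp_affineCap_box₄_of_endPlanes`) and its constant form;
* §5 **the two-sided object-M word**: an S2 floor word of the `t–t'` energy density on the `(U, t', n)`
  projection, transported along `t''` by the kinematic `(16/π²)|t''|` class bound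
  (`tiGroundEnergyDensityAt_tpp_sub_kinematic_le`), glued with a §4 cap — floor side kinematic, cap side exact.

Everything is proved; no definition, no named fact, nothing numerical.

## Mathlib / tree search

REUSED: `FermionInteraction.convexOn_tiGroundEnergyDensityAt`, `…tiGroundEnergyDensityAt_convex_comb_le`,
`exists_isTranslationInvariant_density_eq` (`TIGroundEnergyDensityCouplingFamilies`);
`tiGroundEnergyDensityAt_hubbardTT'T''_zero`, `tiGroundEnergyDensityAt_tpp_sub_kinematic_le`
(`HubbardTTPrimeTPPFillingTransport`, `…KinematicLipschitz`); `affine_nonneg_on_Icc`, `affine₂_nonneg_on_rect`,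
`affine₃_nonneg_on_Icc₃`, `mem_Icc_vec3_iff` (`HubbardTTPrimeAffineBoxWords`, `…Adapters`, `…BoxWordExtension`);
`exists_convexWeights_Icc` (`BoxCoveringByCells`). `lean search 'tiGroundEnergyDensityAt.*chord|affineCap.*tpp'`:
nothing (2026-08-28).

## References

* D. Ruelle, *Statistical Mechanics: Rigorous Results* (1969), §3.3–§3.4 (variational principle; convexity of
  the canonical energy density in the particle density). [cite: Ruelle1969, §3.4]
* R. B. Israel, *Convexity in the Theory of Lattice Gases* (1979), Thm. I.3.4 (concavity / Lipschitz continuity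
  of ground-state energy densities in the couplings). [cite: Israel1979, Thm. I.3.4]
* R. T. Rockafellar, *Convex Analysis* (1970), Thm. 32.2 (an affine function attains its extrema over a polytope
  at vertices). [cite: Rockafellar1970, Thm 32.2]
* E. Pavarini et al., Phys. Rev. Lett. 87 (2001) 047003, eq. (1) (the `t–t'–t''` one-band model).
  [cite: PavariniEtAl2001, eq. (1)]
-/

namespace Literature.MathematicalPhysics.QuantumLattice

open Set ThermodynamicLimit

/-! ### §1 Convexity in the density and the closed density chord for object M -/

/-- **Object M is convex in the density on `(0, 2)`**: for every `t, s, r, u` and every range parameter `R`,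
`n ↦ e^M(t, s, r, u; n)` is convex on `Ioo 0 2` (mixtures of translation-invariant states; every density in
`(0, 2)` is realised on `ℤ²`). [cite: Ruelle1969, §3.4] -/
theorem convexOn_tiGroundEnergyDensityAt_tpp_density (t s r u R : ℝ) :
    ConvexOn ℝ (Ioo (0 : ℝ) 2) fun n => (hubbardTT'T''FermionInteraction t s r u).tiGroundEnergyDensityAt R n :=
  (hubbardTT'T''FermionInteraction t s r u).convexOn_tiGroundEnergyDensityAt R (convex_Ioo 0 2)
    fun _ hρ => exists_isTranslationInvariant_density_eq hρ.1 hρ.2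

/-- **Three-point convexity of object M in the density**: for `0 < m₁, m₂ < 2` and convex weights
`l₁, l₂ ≥ 0`, `l₁ + l₂ = 1`: `e^M(l₁m₁ + l₂m₂) ≤ l₁ e^M(m₁) + l₂ e^M(m₂)`. [cite: Ruelle1969, §3.4] -/
theorem tiGroundEnergyDensityAt_tpp_convex_comb_le (t s r u R : ℝ) {m₁ m₂ : ℝ} (h₁0 : 0 < m₁) (h₁2 : m₁ < 2)
    (h₂0 : 0 < m₂) (h₂2 : m₂ < 2) {l₁ l₂ : ℝ} (hl₁ : 0 ≤ l₁) (hl₂ : 0 ≤ l₂) (hl : l₁ + l₂ = 1) :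
    (hubbardTT'T''FermionInteraction t s r u).tiGroundEnergyDensityAt R (l₁ * m₁ + l₂ * m₂) ≤
      l₁ * (hubbardTT'T''FermionInteraction t s r u).tiGroundEnergyDensityAt R m₁ +
        l₂ * (hubbardTT'T''FermionInteraction t s r u).tiGroundEnergyDensityAt R m₂ :=
  (hubbardTT'T''FermionInteraction t s r u).tiGroundEnergyDensityAt_convex_comb_le R
    (exists_isTranslationInvariant_density_eq h₁0 h₁2) (exists_isTranslationInvariant_density_eq h₂0 h₂2) hl₁ hl₂ hl

/-- **Closed density chord for object M.** For `0 < m₁ < m₂ < 2`, caps `e^M(m₁) ≤ c₁`, `e^M(m₂) ≤ c₂` and every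
`n ∈ [m₁, m₂]`: `e^M(n) ≤ ((m₂ − n) c₁ + (n − m₁) c₂)/(m₂ − m₁)` (the `t''` twin of
`energyDensityTT'_le_density_chord_of_mem_Icc`). [cite: Ruelle1969, §3.4] -/
theorem tiGroundEnergyDensityAt_tpp_le_density_chord_of_mem_Icc (t s r u R : ℝ) {m₁ m₂ c₁ c₂ : ℝ}
    (hm₁ : 0 < m₁) (hm : m₁ < m₂) (hm₂ : m₂ < 2)
    (hc₁ : (hubbardTT'T''FermionInteraction t s r u).tiGroundEnergyDensityAt R m₁ ≤ c₁)
    (hc₂ : (hubbardTT'T''FermionInteraction t s r u).tiGroundEnergyDensityAt R m₂ ≤ c₂)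
    {n : ℝ} (hn : n ∈ Icc m₁ m₂) :
    (hubbardTT'T''FermionInteraction t s r u).tiGroundEnergyDensityAt R n ≤
      ((m₂ - n) * c₁ + (n - m₁) * c₂) / (m₂ - m₁) := by
  have hd : 0 < m₂ - m₁ := sub_pos.2 hm
  set l₁ : ℝ := (m₂ - n) / (m₂ - m₁) with hl₁
  set l₂ : ℝ := (n - m₁) / (m₂ - m₁) with hl₂
  have hl₁0 : 0 ≤ l₁ := div_nonneg (sub_nonneg.2 hn.2) hd.le
  have hl₂0 : 0 ≤ l₂ := div_nonneg (sub_nonneg.2 hn.1) hd.le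
  have hl : l₁ + l₂ = 1 := by
    rw [hl₁, hl₂, ← add_div, div_eq_one_iff_eq hd.ne']
    ring
  have hnn : l₁ * m₁ + l₂ * m₂ = n := by
    rw [hl₁, hl₂, div_mul_eq_mul_div, div_mul_eq_mul_div, ← add_div, div_eq_iff hd.ne']
    ring
  have h := tiGroundEnergyDensityAt_tpp_convex_comb_le t s r u R hm₁ (hm.trans hm₂) (hm₁.trans hm) hm₂ hl₁0 hl₂0 hl
  rw [hnn] at h
  have w₁ := mul_le_mul_of_nonneg_left hc₁ hl₁0
  have w₂ := mul_le_mul_of_nonneg_left hc₂ hl₂0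
  have e : l₁ * c₁ + l₂ * c₂ = ((m₂ - n) * c₁ + (n - m₁) * c₂) / (m₂ - m₁) := by
    rw [hl₁, hl₂]
    field_simp
  linarith

/-! ### §2 Quadrant planes restricted to a box -/

/-- A plane valid on the quadrant `u ≥ 0, s ≤ 0, r ≥ 0` holds on every box inside it (`U₁ ≥ 0`, `s₂ ≤ 0`,
`r₁ ≥ 0`; the hole-doped cuprate quadrant `t' < 0 < t''`). [cite: Rockafellar1970, Thm 32.2] -/
theorem tpp_boxPlane_of_np {t m R P Q S T U₁ U₂ s₁ s₂ r₁ r₂ : ℝ} (hU₁ : 0 ≤ U₁) (hs₂ : s₂ ≤ 0) (hr₁ : 0 ≤ r₁)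
    (h : ∀ u s r : ℝ, 0 ≤ u → s ≤ 0 → 0 ≤ r →
      (hubbardTT'T''FermionInteraction t s r u).tiGroundEnergyDensityAt R m ≤ P + Q * u + S * s + T * r) :
    ∀ u s r : ℝ, U₁ ≤ u → u ≤ U₂ → s₁ ≤ s → s ≤ s₂ → r₁ ≤ r → r ≤ r₂ →
      (hubbardTT'T''FermionInteraction t s r u).tiGroundEnergyDensityAt R m ≤ P + Q * u + S * s + T * r :=
  fun u s r hu _ _ hs hr _ => h u s r (hU₁.trans hu) (hs.trans hs₂) (hr₁.trans hr)

/-- A plane valid on the quadrant `u ≥ 0, s ≤ 0, r ≤ 0` holds on every box inside it (`U₁ ≥ 0`, `s₂ ≤ 0`,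
`r₂ ≤ 0`). [cite: Rockafellar1970, Thm 32.2] -/
theorem tpp_boxPlane_of_nn {t m R P Q S T U₁ U₂ s₁ s₂ r₁ r₂ : ℝ} (hU₁ : 0 ≤ U₁) (hs₂ : s₂ ≤ 0) (hr₂ : r₂ ≤ 0)
    (h : ∀ u s r : ℝ, 0 ≤ u → s ≤ 0 → r ≤ 0 →
      (hubbardTT'T''FermionInteraction t s r u).tiGroundEnergyDensityAt R m ≤ P + Q * u + S * s + T * r) :
    ∀ u s r : ℝ, U₁ ≤ u → u ≤ U₂ → s₁ ≤ s → s ≤ s₂ → r₁ ≤ r → r ≤ r₂ →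
      (hubbardTT'T''FermionInteraction t s r u).tiGroundEnergyDensityAt R m ≤ P + Q * u + S * s + T * r :=
  fun u s r hu _ _ hs _ hr => h u s r (hU₁.trans hu) (hs.trans hs₂) (hr.trans hr₂)

/-- A plane valid on the quadrant `u ≥ 0, s ≥ 0, r ≥ 0` holds on every box inside it (`U₁ ≥ 0`, `s₁ ≥ 0`,
`r₁ ≥ 0`). [cite: Rockafellar1970, Thm 32.2] -/
theorem tpp_boxPlane_of_pp {t m R P Q S T U₁ U₂ s₁ s₂ r₁ r₂ : ℝ} (hU₁ : 0 ≤ U₁) (hs₁ : 0 ≤ s₁) (hr₁ : 0 ≤ r₁)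
    (h : ∀ u s r : ℝ, 0 ≤ u → 0 ≤ s → 0 ≤ r →
      (hubbardTT'T''FermionInteraction t s r u).tiGroundEnergyDensityAt R m ≤ P + Q * u + S * s + T * r) :
    ∀ u s r : ℝ, U₁ ≤ u → u ≤ U₂ → s₁ ≤ s → s ≤ s₂ → r₁ ≤ r → r ≤ r₂ →
      (hubbardTT'T''FermionInteraction t s r u).tiGroundEnergyDensityAt R m ≤ P + Q * u + S * s + T * r :=
  fun u s r hu _ hs _ hr _ => h u s r (hU₁.trans hu) (hs₁.trans hs) (hr₁.trans hr)

/-- A plane valid on the quadrant `u ≥ 0, s ≥ 0, r ≤ 0` holds on every box inside it (`U₁ ≥ 0`, `s₁ ≥ 0`,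
`r₂ ≤ 0`). [cite: Rockafellar1970, Thm 32.2] -/
theorem tpp_boxPlane_of_pn {t m R P Q S T U₁ U₂ s₁ s₂ r₁ r₂ : ℝ} (hU₁ : 0 ≤ U₁) (hs₁ : 0 ≤ s₁) (hr₂ : r₂ ≤ 0)
    (h : ∀ u s r : ℝ, 0 ≤ u → 0 ≤ s → r ≤ 0 →
      (hubbardTT'T''FermionInteraction t s r u).tiGroundEnergyDensityAt R m ≤ P + Q * u + S * s + T * r) :
    ∀ u s r : ℝ, U₁ ≤ u → u ≤ U₂ → s₁ ≤ s → s ≤ s₂ → r₁ ≤ r → r ≤ r₂ →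
      (hubbardTT'T''FermionInteraction t s r u).tiGroundEnergyDensityAt R m ≤ P + Q * u + S * s + T * r :=
  fun u s r hu _ hs _ _ hr => h u s r (hU₁.trans hu) (hs₁.trans hs) (hr.trans hr₂)

/-- Weakening a box plane to a dominating plane (eight vertex checks on the `(u, s, r)` box).
[cite: Rockafellar1970, Thm 32.2] -/
theorem tpp_boxPlane_weaken {t m R P Q S T U₁ U₂ s₁ s₂ r₁ r₂ : ℝ}
    (h : ∀ u s r : ℝ, U₁ ≤ u → u ≤ U₂ → s₁ ≤ s → s ≤ s₂ → r₁ ≤ r → r ≤ r₂ →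
      (hubbardTT'T''FermionInteraction t s r u).tiGroundEnergyDensityAt R m ≤ P + Q * u + S * s + T * r)
    {P' Q' S' T' : ℝ}
    (c₁₁₁ : P + Q * U₁ + S * s₁ + T * r₁ ≤ P' + Q' * U₁ + S' * s₁ + T' * r₁)
    (c₁₁₂ : P + Q * U₁ + S * s₁ + T * r₂ ≤ P' + Q' * U₁ + S' * s₁ + T' * r₂)
    (c₁₂₁ : P + Q * U₁ + S * s₂ + T * r₁ ≤ P' + Q' * U₁ + S' * s₂ + T' * r₁)
    (c₁₂₂ : P + Q * U₁ + S * s₂ + T * r₂ ≤ P' + Q' * U₁ + S' * s₂ + T' * r₂)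
    (c₂₁₁ : P + Q * U₂ + S * s₁ + T * r₁ ≤ P' + Q' * U₂ + S' * s₁ + T' * r₁)
    (c₂₁₂ : P + Q * U₂ + S * s₁ + T * r₂ ≤ P' + Q' * U₂ + S' * s₁ + T' * r₂)
    (c₂₂₁ : P + Q * U₂ + S * s₂ + T * r₁ ≤ P' + Q' * U₂ + S' * s₂ + T' * r₁)
    (c₂₂₂ : P + Q * U₂ + S * s₂ + T * r₂ ≤ P' + Q' * U₂ + S' * s₂ + T' * r₂) :
    ∀ u s r : ℝ, U₁ ≤ u → u ≤ U₂ → s₁ ≤ s → s ≤ s₂ → r₁ ≤ r → r ≤ r₂ →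
      (hubbardTT'T''FermionInteraction t s r u).tiGroundEnergyDensityAt R m ≤ P' + Q' * u + S' * s + T' * r := by
  intro u s r hu₁ hu₂ hs₁ hs₂ hr₁ hr₂
  have h0 := affine₃_nonneg_on_Icc₃ (α := P' - P) (β := Q' - Q) (γ := S' - S) (δ := T' - T)
    (a₀ := U₁) (a₁ := s₁) (a₂ := r₁) (b₀ := U₂) (b₁ := s₂) (b₂ := r₂)
    (by linarith) (by linarith) (by linarith) (by linarith) (by linarith) (by linarith) (by linarith) (by linarith)
    ![u, s, r] (mem_Icc_vec3_iff.2 ⟨⟨hu₁, hu₂⟩, ⟨hs₁, hs₂⟩, ⟨hr₁, hr₂⟩⟩)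
  have h1 := h u s r hu₁ hu₂ hs₁ hs₂ hr₁ hr₂
  simp only [Matrix.cons_val_zero, Matrix.cons_val_one, Matrix.cons_val_two, Matrix.head_cons, Matrix.tail_cons] at h0
  linarith

/-! ### §3 A plane at an arbitrary density from two cluster-density planes -/

/-- **Density chord of two box planes.** Planes at the (cluster) densities `m₁, m₂ ∈ (0, 2)` valid on the
`(u, s, r)` box, convex weights `l₁, l₂ ≥ 0`, `l₁ + l₂ = 1` with `l₁m₁ + l₂m₂ = n`, and a target plane whose
eight vertex values dominate the weighted planes: then the target is a cap plane at density `n` on the box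
(convexity of `e^M` in the density + the vertex rule). [cite: Ruelle1969, §3.4] [cite: Rockafellar1970, Thm 32.2] -/
theorem tpp_boxPlane_of_densityChord {t R U₁ U₂ s₁ s₂ r₁ r₂ m₁ m₂ n l₁ l₂ : ℝ}
    (h₁0 : 0 < m₁) (h₁2 : m₁ < 2) (h₂0 : 0 < m₂) (h₂2 : m₂ < 2)
    (hl₁ : 0 ≤ l₁) (hl₂ : 0 ≤ l₂) (hl : l₁ + l₂ = 1) (hn : l₁ * m₁ + l₂ * m₂ = n)
    {P₁ Q₁ S₁ T₁ P₂ Q₂ S₂ T₂ : ℝ}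
    (hC₁ : ∀ u s r : ℝ, U₁ ≤ u → u ≤ U₂ → s₁ ≤ s → s ≤ s₂ → r₁ ≤ r → r ≤ r₂ →
      (hubbardTT'T''FermionInteraction t s r u).tiGroundEnergyDensityAt R m₁ ≤ P₁ + Q₁ * u + S₁ * s + T₁ * r)
    (hC₂ : ∀ u s r : ℝ, U₁ ≤ u → u ≤ U₂ → s₁ ≤ s → s ≤ s₂ → r₁ ≤ r → r ≤ r₂ →
      (hubbardTT'T''FermionInteraction t s r u).tiGroundEnergyDensityAt R m₂ ≤ P₂ + Q₂ * u + S₂ * s + T₂ * r)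
    {P Q S T : ℝ}
    (c₁₁₁ : l₁ * (P₁ + Q₁ * U₁ + S₁ * s₁ + T₁ * r₁) + l₂ * (P₂ + Q₂ * U₁ + S₂ * s₁ + T₂ * r₁) ≤ P + Q * U₁ + S * s₁ + T * r₁)
    (c₁₁₂ : l₁ * (P₁ + Q₁ * U₁ + S₁ * s₁ + T₁ * r₂) + l₂ * (P₂ + Q₂ * U₁ + S₂ * s₁ + T₂ * r₂) ≤ P + Q * U₁ + S * s₁ + T * r₂)
    (c₁₂₁ : l₁ * (P₁ + Q₁ * U₁ + S₁ * s₂ + T₁ * r₁) + l₂ * (P₂ + Q₂ * U₁ + S₂ * s₂ + T₂ * r₁) ≤ P + Q * U₁ + S * s₂ + T * r₁)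
    (c₁₂₂ : l₁ * (P₁ + Q₁ * U₁ + S₁ * s₂ + T₁ * r₂) + l₂ * (P₂ + Q₂ * U₁ + S₂ * s₂ + T₂ * r₂) ≤ P + Q * U₁ + S * s₂ + T * r₂)
    (c₂₁₁ : l₁ * (P₁ + Q₁ * U₂ + S₁ * s₁ + T₁ * r₁) + l₂ * (P₂ + Q₂ * U₂ + S₂ * s₁ + T₂ * r₁) ≤ P + Q * U₂ + S * s₁ + T * r₁)
    (c₂₁₂ : l₁ * (P₁ + Q₁ * U₂ + S₁ * s₁ + T₁ * r₂) + l₂ * (P₂ + Q₂ * U₂ + S₂ * s₁ + T₂ * r₂) ≤ P + Q * U₂ + S * s₁ + T * r₂)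
    (c₂₂₁ : l₁ * (P₁ + Q₁ * U₂ + S₁ * s₂ + T₁ * r₁) + l₂ * (P₂ + Q₂ * U₂ + S₂ * s₂ + T₂ * r₁) ≤ P + Q * U₂ + S * s₂ + T * r₁)
    (c₂₂₂ : l₁ * (P₁ + Q₁ * U₂ + S₁ * s₂ + T₁ * r₂) + l₂ * (P₂ + Q₂ * U₂ + S₂ * s₂ + T₂ * r₂) ≤ P + Q * U₂ + S * s₂ + T * r₂) :
    ∀ u s r : ℝ, U₁ ≤ u → u ≤ U₂ → s₁ ≤ s → s ≤ s₂ → r₁ ≤ r → r ≤ r₂ →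
      (hubbardTT'T''FermionInteraction t s r u).tiGroundEnergyDensityAt R n ≤ P + Q * u + S * s + T * r := by
  intro u s r hu₁ hu₂ hs₁ hs₂ hr₁ hr₂
  have hconv := tiGroundEnergyDensityAt_tpp_convex_comb_le t s r u R h₁0 h₁2 h₂0 h₂2 hl₁ hl₂ hl
  rw [hn] at hconv
  have w₁ := mul_le_mul_of_nonneg_left (hC₁ u s r hu₁ hu₂ hs₁ hs₂ hr₁ hr₂) hl₁
  have w₂ := mul_le_mul_of_nonneg_left (hC₂ u s r hu₁ hu₂ hs₁ hs₂ hr₁ hr₂) hl₂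
  -- the target dominates the weighted planes on the box (affine, vertex rule)
  have h0 := affine₃_nonneg_on_Icc₃ (α := P - (l₁ * P₁ + l₂ * P₂)) (β := Q - (l₁ * Q₁ + l₂ * Q₂))
    (γ := S - (l₁ * S₁ + l₂ * S₂)) (δ := T - (l₁ * T₁ + l₂ * T₂))
    (a₀ := U₁) (a₁ := s₁) (a₂ := r₁) (b₀ := U₂) (b₁ := s₂) (b₂ := r₂)
    (by linarith) (by linarith) (by linarith) (by linarith) (by linarith) (by linarith) (by linarith) (by linarith)
    ![u, s, r] (mem_Icc_vec3_iff.2 ⟨⟨hu₁, hu₂⟩, ⟨hs₁, hs₂⟩, ⟨hr₁, hr₂⟩⟩)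
  simp only [Matrix.cons_val_zero, Matrix.cons_val_one, Matrix.cons_val_two, Matrix.head_cons, Matrix.tail_cons] at h0
  linarith

/-! ### §4 Affine and constant caps on the four-dimensional box from two end-density planes -/

/-- **AFFINE CAP ON A `(U, t', t'', n)` BOX FROM TWO END-DENSITY PLANES.** Box
`[U₁, U₂] × [s₁, s₂] × [r₁, r₂] × [n₁, n₂]` with `0 < n₁ < n₂ < 2`; two cap planes of object M, affine in
`(u, s, r)` and valid on the `(u, s, r)` box, at the slab ends `n₁`, `n₂`; and an affine candidate
`H(u, s, r, n) = H₀ + H₁u + H₂s + H₃r + H₄n` whose sixteen vertex values are above the planes. Then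
`e^M ≤ H` on the whole box: `e^M(t, s, r, u; ·)` is convex in the density, hence below the chord of the two
planes; the chord is affine in `(u, s, r)` at fixed `n` and `H` dominates it at the vertices, hence everywhere
(the `t''` twin of `energyDensityTT'_affineCap_Icc₃_of_endPlanes`). [cite: Ruelle1969, §3.4] [cite: Rockafellar1970, Thm 32.2] -/
theorem tpp_affineCap_box₄_of_endPlanes {t R U₁ U₂ s₁ s₂ r₁ r₂ n₁ n₂ : ℝ}
    (hn0 : 0 < n₁) (hn : n₁ < n₂) (hn2 : n₂ < 2)
    {P₁ Q₁ S₁ T₁ P₂ Q₂ S₂ T₂ : ℝ}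
    (hC₁ : ∀ u s r : ℝ, U₁ ≤ u → u ≤ U₂ → s₁ ≤ s → s ≤ s₂ → r₁ ≤ r → r ≤ r₂ →
      (hubbardTT'T''FermionInteraction t s r u).tiGroundEnergyDensityAt R n₁ ≤ P₁ + Q₁ * u + S₁ * s + T₁ * r)
    (hC₂ : ∀ u s r : ℝ, U₁ ≤ u → u ≤ U₂ → s₁ ≤ s → s ≤ s₂ → r₁ ≤ r → r ≤ r₂ →
      (hubbardTT'T''FermionInteraction t s r u).tiGroundEnergyDensityAt R n₂ ≤ P₂ + Q₂ * u + S₂ * s + T₂ * r)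
    {H₀ H₁ H₂ H₃ H₄ : ℝ}
    (c₁₁₁₁ : P₁ + Q₁ * U₁ + S₁ * s₁ + T₁ * r₁ ≤ H₀ + H₁ * U₁ + H₂ * s₁ + H₃ * r₁ + H₄ * n₁)
    (c₁₁₂₁ : P₁ + Q₁ * U₁ + S₁ * s₁ + T₁ * r₂ ≤ H₀ + H₁ * U₁ + H₂ * s₁ + H₃ * r₂ + H₄ * n₁)
    (c₁₂₁₁ : P₁ + Q₁ * U₁ + S₁ * s₂ + T₁ * r₁ ≤ H₀ + H₁ * U₁ + H₂ * s₂ + H₃ * r₁ + H₄ * n₁)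
    (c₁₂₂₁ : P₁ + Q₁ * U₁ + S₁ * s₂ + T₁ * r₂ ≤ H₀ + H₁ * U₁ + H₂ * s₂ + H₃ * r₂ + H₄ * n₁)
    (c₂₁₁₁ : P₁ + Q₁ * U₂ + S₁ * s₁ + T₁ * r₁ ≤ H₀ + H₁ * U₂ + H₂ * s₁ + H₃ * r₁ + H₄ * n₁)
    (c₂₁₂₁ : P₁ + Q₁ * U₂ + S₁ * s₁ + T₁ * r₂ ≤ H₀ + H₁ * U₂ + H₂ * s₁ + H₃ * r₂ + H₄ * n₁)
    (c₂₂₁₁ : P₁ + Q₁ * U₂ + S₁ * s₂ + T₁ * r₁ ≤ H₀ + H₁ * U₂ + H₂ * s₂ + H₃ * r₁ + H₄ * n₁)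
    (c₂₂₂₁ : P₁ + Q₁ * U₂ + S₁ * s₂ + T₁ * r₂ ≤ H₀ + H₁ * U₂ + H₂ * s₂ + H₃ * r₂ + H₄ * n₁)
    (c₁₁₁₂ : P₂ + Q₂ * U₁ + S₂ * s₁ + T₂ * r₁ ≤ H₀ + H₁ * U₁ + H₂ * s₁ + H₃ * r₁ + H₄ * n₂)
    (c₁₁₂₂ : P₂ + Q₂ * U₁ + S₂ * s₁ + T₂ * r₂ ≤ H₀ + H₁ * U₁ + H₂ * s₁ + H₃ * r₂ + H₄ * n₂)
    (c₁₂₁₂ : P₂ + Q₂ * U₁ + S₂ * s₂ + T₂ * r₁ ≤ H₀ + H₁ * U₁ + H₂ * s₂ + H₃ * r₁ + H₄ * n₂)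
    (c₁₂₂₂ : P₂ + Q₂ * U₁ + S₂ * s₂ + T₂ * r₂ ≤ H₀ + H₁ * U₁ + H₂ * s₂ + H₃ * r₂ + H₄ * n₂)
    (c₂₁₁₂ : P₂ + Q₂ * U₂ + S₂ * s₁ + T₂ * r₁ ≤ H₀ + H₁ * U₂ + H₂ * s₁ + H₃ * r₁ + H₄ * n₂)
    (c₂₁₂₂ : P₂ + Q₂ * U₂ + S₂ * s₁ + T₂ * r₂ ≤ H₀ + H₁ * U₂ + H₂ * s₁ + H₃ * r₂ + H₄ * n₂)
    (c₂₂₁₂ : P₂ + Q₂ * U₂ + S₂ * s₂ + T₂ * r₁ ≤ H₀ + H₁ * U₂ + H₂ * s₂ + H₃ * r₁ + H₄ * n₂)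
    (c₂₂₂₂ : P₂ + Q₂ * U₂ + S₂ * s₂ + T₂ * r₂ ≤ H₀ + H₁ * U₂ + H₂ * s₂ + H₃ * r₂ + H₄ * n₂) :
    ∀ u s r n : ℝ, U₁ ≤ u → u ≤ U₂ → s₁ ≤ s → s ≤ s₂ → r₁ ≤ r → r ≤ r₂ → n₁ ≤ n → n ≤ n₂ →
      (hubbardTT'T''FermionInteraction t s r u).tiGroundEnergyDensityAt R n ≤
        H₀ + H₁ * u + H₂ * s + H₃ * r + H₄ * n := by
  intro u s r n hu₁ hu₂ hs₁ hs₂ hr₁ hr₂ hm₁ hm₂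
  have hd : 0 < n₂ - n₁ := sub_pos.2 hn
  have hmem : (![u, s, r] : Fin 3 → ℝ) ∈ Set.Icc (![U₁, s₁, r₁] : Fin 3 → ℝ) ![U₂, s₂, r₂] :=
    mem_Icc_vec3_iff.2 ⟨⟨hu₁, hu₂⟩, ⟨hs₁, hs₂⟩, ⟨hr₁, hr₂⟩⟩
  -- density chord of the two planes at `(u, s, r)`
  have hch := tiGroundEnergyDensityAt_tpp_le_density_chord_of_mem_Icc t s r u R hn0 hn hn2
    (hC₁ u s r hu₁ hu₂ hs₁ hs₂ hr₁ hr₂) (hC₂ u s r hu₁ hu₂ hs₁ hs₂ hr₁ hr₂) ⟨hm₁, hm₂⟩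
  -- `H` is above each plane on the box (vertices ⇒ box)
  have k₁ : P₁ + Q₁ * u + S₁ * s + T₁ * r ≤ H₀ + H₁ * u + H₂ * s + H₃ * r + H₄ * n₁ := by
    have h0 := affine₃_nonneg_on_Icc₃ (α := H₀ + H₄ * n₁ - P₁) (β := H₁ - Q₁) (γ := H₂ - S₁) (δ := H₃ - T₁)
      (a₀ := U₁) (a₁ := s₁) (a₂ := r₁) (b₀ := U₂) (b₁ := s₂) (b₂ := r₂)
      (by linarith) (by linarith) (by linarith) (by linarith) (by linarith) (by linarith) (by linarith) (by linarith)
      ![u, s, r] hmem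
    simp only [Matrix.cons_val_zero, Matrix.cons_val_one, Matrix.cons_val_two, Matrix.head_cons,
      Matrix.tail_cons] at h0
    linarith
  have k₂ : P₂ + Q₂ * u + S₂ * s + T₂ * r ≤ H₀ + H₁ * u + H₂ * s + H₃ * r + H₄ * n₂ := by
    have h0 := affine₃_nonneg_on_Icc₃ (α := H₀ + H₄ * n₂ - P₂) (β := H₁ - Q₂) (γ := H₂ - S₂) (δ := H₃ - T₂)
      (a₀ := U₁) (a₁ := s₁) (a₂ := r₁) (b₀ := U₂) (b₁ := s₂) (b₂ := r₂)
      (by linarith) (by linarith) (by linarith) (by linarith) (by linarith) (by linarith) (by linarith) (by linarith)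
      ![u, s, r] hmem
    simp only [Matrix.cons_val_zero, Matrix.cons_val_one, Matrix.cons_val_two, Matrix.head_cons,
      Matrix.tail_cons] at h0
    linarith
  have w₁ := mul_le_mul_of_nonneg_left k₁ (sub_nonneg.2 hm₂)
  have w₂ := mul_le_mul_of_nonneg_left k₂ (sub_nonneg.2 hm₁)
  refine hch.trans ?_
  rw [div_le_iff₀ hd]
  nlinarith [w₁, w₂]

/-- **CONSTANT CAP on a `(U, t', t'', n)` box from two end-density planes**: sixteen vertex values of the two
planes `≤ C` ⇒ `e^M ≤ C` on the box (`0 < n₁ < n₂ < 2`). [cite: Ruelle1969, §3.4] [cite: Rockafellar1970, Thm 32.2] -/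
theorem tpp_constCap_box₄_of_endPlanes {t R U₁ U₂ s₁ s₂ r₁ r₂ n₁ n₂ : ℝ}
    (hn0 : 0 < n₁) (hn : n₁ < n₂) (hn2 : n₂ < 2)
    {P₁ Q₁ S₁ T₁ P₂ Q₂ S₂ T₂ : ℝ}
    (hC₁ : ∀ u s r : ℝ, U₁ ≤ u → u ≤ U₂ → s₁ ≤ s → s ≤ s₂ → r₁ ≤ r → r ≤ r₂ →
      (hubbardTT'T''FermionInteraction t s r u).tiGroundEnergyDensityAt R n₁ ≤ P₁ + Q₁ * u + S₁ * s + T₁ * r)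
    (hC₂ : ∀ u s r : ℝ, U₁ ≤ u → u ≤ U₂ → s₁ ≤ s → s ≤ s₂ → r₁ ≤ r → r ≤ r₂ →
      (hubbardTT'T''FermionInteraction t s r u).tiGroundEnergyDensityAt R n₂ ≤ P₂ + Q₂ * u + S₂ * s + T₂ * r)
    {C : ℝ}
    (c₁₁₁₁ : P₁ + Q₁ * U₁ + S₁ * s₁ + T₁ * r₁ ≤ C) (c₁₁₂₁ : P₁ + Q₁ * U₁ + S₁ * s₁ + T₁ * r₂ ≤ C)
    (c₁₂₁₁ : P₁ + Q₁ * U₁ + S₁ * s₂ + T₁ * r₁ ≤ C) (c₁₂₂₁ : P₁ + Q₁ * U₁ + S₁ * s₂ + T₁ * r₂ ≤ C)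
    (c₂₁₁₁ : P₁ + Q₁ * U₂ + S₁ * s₁ + T₁ * r₁ ≤ C) (c₂₁₂₁ : P₁ + Q₁ * U₂ + S₁ * s₁ + T₁ * r₂ ≤ C)
    (c₂₂₁₁ : P₁ + Q₁ * U₂ + S₁ * s₂ + T₁ * r₁ ≤ C) (c₂₂₂₁ : P₁ + Q₁ * U₂ + S₁ * s₂ + T₁ * r₂ ≤ C)
    (c₁₁₁₂ : P₂ + Q₂ * U₁ + S₂ * s₁ + T₂ * r₁ ≤ C) (c₁₁₂₂ : P₂ + Q₂ * U₁ + S₂ * s₁ + T₂ * r₂ ≤ C)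
    (c₁₂₁₂ : P₂ + Q₂ * U₁ + S₂ * s₂ + T₂ * r₁ ≤ C) (c₁₂₂₂ : P₂ + Q₂ * U₁ + S₂ * s₂ + T₂ * r₂ ≤ C)
    (c₂₁₁₂ : P₂ + Q₂ * U₂ + S₂ * s₁ + T₂ * r₁ ≤ C) (c₂₁₂₂ : P₂ + Q₂ * U₂ + S₂ * s₁ + T₂ * r₂ ≤ C)
    (c₂₂₁₂ : P₂ + Q₂ * U₂ + S₂ * s₂ + T₂ * r₁ ≤ C) (c₂₂₂₂ : P₂ + Q₂ * U₂ + S₂ * s₂ + T₂ * r₂ ≤ C) :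
    ∀ u s r n : ℝ, U₁ ≤ u → u ≤ U₂ → s₁ ≤ s → s ≤ s₂ → r₁ ≤ r → r ≤ r₂ → n₁ ≤ n → n ≤ n₂ →
      (hubbardTT'T''FermionInteraction t s r u).tiGroundEnergyDensityAt R n ≤ C := by
  intro u s r n hu₁ hu₂ hs₁ hs₂ hr₁ hr₂ hm₁ hm₂
  have h := tpp_affineCap_box₄_of_endPlanes (H₀ := C) (H₁ := 0) (H₂ := 0) (H₃ := 0) (H₄ := 0) hn0 hn hn2 hC₁ hC₂
    (by linarith) (by linarith) (by linarith) (by linarith) (by linarith) (by linarith) (by linarith) (by linarith)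
    (by linarith) (by linarith) (by linarith) (by linarith) (by linarith) (by linarith) (by linarith) (by linarith)
    u s r n hu₁ hu₂ hs₁ hs₂ hr₁ hr₂ hm₁ hm₂
  linarith

/-- **Constant cap on a box of ONE density row** (`n₁ = n₂ = m`, a cluster density): eight vertex values of one
plane `≤ C` ⇒ `e^M(·; m) ≤ C` on the `(u, s, r)` box. [cite: Rockafellar1970, Thm 32.2] -/
theorem tpp_constCap_box_of_plane {t m R P Q S T U₁ U₂ s₁ s₂ r₁ r₂ : ℝ}
    (h : ∀ u s r : ℝ, U₁ ≤ u → u ≤ U₂ → s₁ ≤ s → s ≤ s₂ → r₁ ≤ r → r ≤ r₂ →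
      (hubbardTT'T''FermionInteraction t s r u).tiGroundEnergyDensityAt R m ≤ P + Q * u + S * s + T * r)
    {C : ℝ}
    (c₁₁₁ : P + Q * U₁ + S * s₁ + T * r₁ ≤ C) (c₁₁₂ : P + Q * U₁ + S * s₁ + T * r₂ ≤ C)
    (c₁₂₁ : P + Q * U₁ + S * s₂ + T * r₁ ≤ C) (c₁₂₂ : P + Q * U₁ + S * s₂ + T * r₂ ≤ C)
    (c₂₁₁ : P + Q * U₂ + S * s₁ + T * r₁ ≤ C) (c₂₁₂ : P + Q * U₂ + S * s₁ + T * r₂ ≤ C)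
    (c₂₂₁ : P + Q * U₂ + S * s₂ + T * r₁ ≤ C) (c₂₂₂ : P + Q * U₂ + S * s₂ + T * r₂ ≤ C) :
    ∀ u s r : ℝ, U₁ ≤ u → u ≤ U₂ → s₁ ≤ s → s ≤ s₂ → r₁ ≤ r → r ≤ r₂ →
      (hubbardTT'T''FermionInteraction t s r u).tiGroundEnergyDensityAt R m ≤ C := by
  intro u s r hu₁ hu₂ hs₁ hs₂ hr₁ hr₂
  have h' := tpp_boxPlane_weaken h (P' := C) (Q' := 0) (S' := 0) (T' := 0)
    (by linarith) (by linarith) (by linarith) (by linarith) (by linarith) (by linarith) (by linarith) (by linarith)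
    u s r hu₁ hu₂ hs₁ hs₂ hr₁ hr₂
  linarith

/-! ### §5 The two-sided object-M word: transported `t–t'` floor, exact cap -/

/-- **Floor of object M on a `(U, t', t'', n)` box from an S2 floor word on the `(U, t', n)` projection**
(kinematic transport along `t''`): if `F ≤ e(1, s, u, n)` on `Set.Icc ![U₁, s₁, n₁] ![U₂, s₂, n₂]` (the seam's
`θ 0 = U, θ 1 = t', θ 2 = n` shape; `U₁ ≥ 0`, `0 < n₁`, `n₂ < 2`), then for every `(u, s, r, n)` of the 4-box with
`|r| ≤ ρ₃`: `F − (16/π²) ρ₃ ≤ e^M(1, s, r, u; n)`. [cite: Israel1979, Thm. I.3.4] -/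
theorem tpp_floor_box₄_of_floor_Icc₃ {U₁ U₂ s₁ s₂ r₁ r₂ n₁ n₂ F ρ₃ : ℝ} (hU₁ : 0 ≤ U₁) (hn0 : 0 < n₁) (hn2 : n₂ < 2)
    (hF : ∀ θ ∈ Set.Icc (![U₁, s₁, n₁] : Fin 3 → ℝ) ![U₂, s₂, n₂], F ≤ energyDensityTT' 1 (θ 1) (θ 0) (θ 2))
    (hρ : ∀ r ∈ Set.Icc r₁ r₂, |r| ≤ ρ₃) :
    ∀ u s r n : ℝ, U₁ ≤ u → u ≤ U₂ → s₁ ≤ s → s ≤ s₂ → r₁ ≤ r → r ≤ r₂ → n₁ ≤ n → n ≤ n₂ →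
      F - 16 / Real.pi ^ 2 * ρ₃ ≤ (hubbardTT'T''FermionInteraction 1 s r u).tiGroundEnergyDensityAt 2 n := by
  intro u s r n hu₁ hu₂ hs₁ hs₂ hr₁ hr₂ hm₁ hm₂
  have hu0 : 0 ≤ u := hU₁.trans hu₁
  have hn0' : 0 < n := lt_of_lt_of_le hn0 hm₁
  have hn2' : n < 2 := lt_of_le_of_lt hm₂ hn2
  have hfl := hF ![u, s, n] (mem_Icc_vec3_iff.2 ⟨⟨hu₁, hu₂⟩, ⟨hs₁, hs₂⟩, ⟨hm₁, hm₂⟩⟩)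
  simp only [Matrix.cons_val_zero, Matrix.cons_val_one, Matrix.cons_val_two, Matrix.head_cons,
    Matrix.tail_cons] at hfl
  have h0 := tiGroundEnergyDensityAt_tpp_sub_kinematic_le 1 s u hn0' hn2' r 0
  rw [tiGroundEnergyDensityAt_hubbardTT'T''_zero 1 s hu0 hn0' hn2', sub_zero] at h0
  have hk : 16 / Real.pi ^ 2 * |r| ≤ 16 / Real.pi ^ 2 * ρ₃ :=
    mul_le_mul_of_nonneg_left (hρ r ⟨hr₁, hr₂⟩) (by positivity)
  linarith

/-- `|r| ≤ max |r₁| |r₂|` on `[r₁, r₂]` (the seam's allowance radius). [folklore] -/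
private theorem abs_le_max_abs_of_mem_Icc {r₁ r₂ r : ℝ} (h : r ∈ Set.Icc r₁ r₂) : |r| ≤ max |r₁| |r₂| := by
  rcases le_or_gt 0 r with hr | hr
  · rw [abs_of_nonneg hr]
    exact le_trans (h.2.trans (le_abs_self r₂)) (le_max_right _ _)
  · rw [abs_of_neg hr]
    exact le_trans (by linarith [h.1, neg_abs_le r₁, neg_le_abs r₁]) (le_max_left _ _)

/-- **THE TWO-SIDED OBJECT-M WORD ON A `(U, t', t'', n)` BOX** — floor kinematic, cap exact: an S2 floor word
`F ≤ e(1, s, u, n)` on the `(U, t', n)` projection (`U₁ ≥ 0`, `0 < n₁`, `n₂ < 2`) and an object-M cap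
`e^M ≤ H₀ + H₁u + H₂s + H₃r + H₄n` on the 4-box give, at every point of the 4-box,
`F − (16/π²)·max(|r₁|,|r₂|) ≤ e^M(1, s, r, u; n) ≤ H₀ + H₁u + H₂s + H₃r + H₄n`.
[cite: Israel1979, Thm. I.3.4] [cite: Ruelle1969, §3.4] -/
theorem tpp_word_box₄_of_floor_Icc₃_of_cap {U₁ U₂ s₁ s₂ r₁ r₂ n₁ n₂ F H₀ H₁ H₂ H₃ H₄ : ℝ}
    (hU₁ : 0 ≤ U₁) (hn0 : 0 < n₁) (hn2 : n₂ < 2)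
    (hF : ∀ θ ∈ Set.Icc (![U₁, s₁, n₁] : Fin 3 → ℝ) ![U₂, s₂, n₂], F ≤ energyDensityTT' 1 (θ 1) (θ 0) (θ 2))
    (hC : ∀ u s r n : ℝ, U₁ ≤ u → u ≤ U₂ → s₁ ≤ s → s ≤ s₂ → r₁ ≤ r → r ≤ r₂ → n₁ ≤ n → n ≤ n₂ →
      (hubbardTT'T''FermionInteraction 1 s r u).tiGroundEnergyDensityAt 2 n ≤ H₀ + H₁ * u + H₂ * s + H₃ * r + H₄ * n) :
    ∀ u s r n : ℝ, U₁ ≤ u → u ≤ U₂ → s₁ ≤ s → s ≤ s₂ → r₁ ≤ r → r ≤ r₂ → n₁ ≤ n → n ≤ n₂ →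
      F - 16 / Real.pi ^ 2 * max |r₁| |r₂| ≤ (hubbardTT'T''FermionInteraction 1 s r u).tiGroundEnergyDensityAt 2 n ∧
        (hubbardTT'T''FermionInteraction 1 s r u).tiGroundEnergyDensityAt 2 n ≤ H₀ + H₁ * u + H₂ * s + H₃ * r + H₄ * n :=
  fun u s r n hu₁ hu₂ hs₁ hs₂ hr₁ hr₂ hm₁ hm₂ =>
    ⟨tpp_floor_box₄_of_floor_Icc₃ hU₁ hn0 hn2 hF (fun _ hx => abs_le_max_abs_of_mem_Icc hx)
        u s r n hu₁ hu₂ hs₁ hs₂ hr₁ hr₂ hm₁ hm₂,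
      hC u s r n hu₁ hu₂ hs₁ hs₂ hr₁ hr₂ hm₁ hm₂⟩

/-- **Decimal allowance**: `16/π² · m ≤ 1.6212 · m` for `m ≥ 0` (`π > 3.141592`), for the word's decimal
enclosure. [folklore] -/
private theorem kinematicAllowance_le (m : ℝ) (hm : 0 ≤ m) : 16 / Real.pi ^ 2 * m ≤ 1.6212 * m := by
  refine mul_le_mul_of_nonneg_right ?_ hm
  have hπ : (3.141592 : ℝ) < Real.pi := Real.pi_gt_d6
  have hπ2 : (3.141592 : ℝ) ^ 2 < Real.pi ^ 2 := by
    exact pow_lt_pow_left₀ hπ (by norm_num) (by norm_num)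
  rw [div_le_iff₀ (by positivity)]
  nlinarith

/-- **Decimal form of the two-sided word**: with `F − 1.6212·max(|r₁|,|r₂|) ≥ L` the word reads `L ≤ e^M ≤ H`.
[cite: Israel1979, Thm. I.3.4] -/
theorem tpp_word_box₄_decimal {U₁ U₂ s₁ s₂ r₁ r₂ n₁ n₂ F H₀ H₁ H₂ H₃ H₄ L : ℝ}
    (hU₁ : 0 ≤ U₁) (hn0 : 0 < n₁) (hn2 : n₂ < 2)
    (hF : ∀ θ ∈ Set.Icc (![U₁, s₁, n₁] : Fin 3 → ℝ) ![U₂, s₂, n₂], F ≤ energyDensityTT' 1 (θ 1) (θ 0) (θ 2))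
    (hC : ∀ u s r n : ℝ, U₁ ≤ u → u ≤ U₂ → s₁ ≤ s → s ≤ s₂ → r₁ ≤ r → r ≤ r₂ → n₁ ≤ n → n ≤ n₂ →
      (hubbardTT'T''FermionInteraction 1 s r u).tiGroundEnergyDensityAt 2 n ≤ H₀ + H₁ * u + H₂ * s + H₃ * r + H₄ * n)
    (hL : L ≤ F - 1.6212 * max |r₁| |r₂|) :
    ∀ u s r n : ℝ, U₁ ≤ u → u ≤ U₂ → s₁ ≤ s → s ≤ s₂ → r₁ ≤ r → r ≤ r₂ → n₁ ≤ n → n ≤ n₂ →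
      L ≤ (hubbardTT'T''FermionInteraction 1 s r u).tiGroundEnergyDensityAt 2 n ∧
        (hubbardTT'T''FermionInteraction 1 s r u).tiGroundEnergyDensityAt 2 n ≤ H₀ + H₁ * u + H₂ * s + H₃ * r + H₄ * n := by
  intro u s r n hu₁ hu₂ hs₁ hs₂ hr₁ hr₂ hm₁ hm₂
  have h := tpp_word_box₄_of_floor_Icc₃_of_cap hU₁ hn0 hn2 hF hC u s r n hu₁ hu₂ hs₁ hs₂ hr₁ hr₂ hm₁ hm₂
  have ha := kinematicAllowance_le (max |r₁| |r₂|) (le_trans (abs_nonneg r₁) (le_max_left _ _))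
  exact ⟨by linarith [h.1], h.2⟩

end Literature.MathematicalPhysics.QuantumLattice
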